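import Literature.Barriers.NavierStokesRegularity.LeraySelfSimilarBlowupExclusion
import Literature.Analysis.FluidPDE.TsaiLocalEnergyRRS
import Literature.Analysis.FluidPDE.CKNLocalRegularityRRSPressure
import Literature.Analysis.FluidPDE.PineauVicolRSSHolds
import HarnessLib

/-!
# Barrier: no Leray (backward) self-similar blow-up — proofs layer

Proofs layer (theorems only; no definitions, no named facts) for the barrier catalogue entry
`Literature.Barriers.NavierStokesRegularity.LeraySelfSimilarBlowupExclusion`
(`LeraySelfSimilarBlowupExclusion.lean`, D-0021): the conjunction of the three in-tree named facts
`Literature.Analysis.FluidPDE.necas_ruzicka_sverak` (J. Nečas, M. Růžička, V. Šverák, Acta Math. 176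
(1996), **Theorem 1**, p. 291: a weak solution `U ∈ L³(ℝ³)` of Leray's profile system (1.3)
vanishes), `Literature.Analysis.FluidPDE.tsai_selfsimilar` (T.-P. Tsai, Arch. Rational Mech. Anal.
143 (1998), **Theorem 1**, p. 31: the same for `U ∈ L^q`, `3 < q < ∞`) and
`Literature.Analysis.FluidPDE.tsai_selfsimilar_local_energy` (ibid., **Theorem 2**, p. 31: the same
under the local energy estimates (1.4) near the singularity).

## State of the three conjuncts (this file)

* `tsai_selfsimilar` is **proved**: `tsai_selfsimilar_holds` (`TsaiSelfSimilarHolds.lean`; Tsai's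
  §5 endgame over the discharged regularity of profiles, Lemma 3.3, the interior Stokes estimate
  and Stein's bound for the normalised pressure).
* `necas_ruzicka_sverak` and `tsai_selfsimilar_local_energy` are proved in the tree **from the
  Caffarelli–Kohn–Nirenberg one-scale ε-regularity criterion**, in either of two renderings:
  Robinson–Rodrigo–Sadowski's Thm. 15.3 (`RRS2016.theorem15_3`; `necas_ruzicka_sverak_of_theorem15_3`,
  `NecasRuzickaSverakRRS.lean`; `tsai_selfsimilar_local_energy_of_theorem15_3`,
  `TsaiLocalEnergyRRS.lean`), itself reduced to the single named fact `RRS2016.lemma15_12`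
  (the local pressure estimate, RRS Lemma 15.12; `RRS2016.theorem15_3_of_lemma15_12` with
  `RRS2016.step2_force_holds`, Lemma 15.11 and Steps 1–4 proved), or Lemarié-Rieusset's Thm. 14.4
  (`lemarieRieusset_epsilon_regularity`; `necas_ruzicka_sverak_of_LR`,
  `tsai_selfsimilar_local_energy_of_LR`).

Accordingly this file proves the barrier **conditionally, with a one-fact trust base**:

* `leraySelfSimilarBlowupExclusion_of_lemma15_12 : RRS2016.lemma15_12 → LeraySelfSimilarBlowupExclusion`;
* `leraySelfSimilarBlowupExclusion_of_theorem15_3 : RRS2016.theorem15_3 → LeraySelfSimilarBlowupExclusion`;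
* `leraySelfSimilarBlowupExclusion_of_LR : lemarieRieusset_epsilon_regularity → LeraySelfSimilarBlowupExclusion`.

`RRS2016.lemma15_12` is now discharged (`RRS2016.lemma15_12_holds`,
`CKNLocalRegularityRRSPressure.lean`), so the barrier is **proved**:
`LeraySelfSimilarBlowupExclusion_holds` (last section; the three conjuncts are individually
discharged in `NecasRuzickaSverakHolds.lean`, `TsaiSelfSimilarHolds.lean`,
`TsaiLocalEnergyHolds.lean`).

## The narrowed entry (audit 2026-08-16)

`LeraySelfSimilarBlowupExclusionNarrow` (same statement file) is the conjunction of
`LeraySelfSimilarBlowupExclusion` with the named fact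
`Literature.Analysis.FluidPDE.pineauVicol2026_rss_liouville` (B. Pineau, V. Vicol,
arXiv:2607.09619 (2026), **Theorem 1.4**, p. 4: Type I rotated self-similar solutions with
angular speed `|α| ≪ 1` or `|α| ≫ 1` are trivial). That fact is discharged in the tree,
`Literature.Analysis.FluidPDE.pineauVicol2026_rss_liouville_holds` (`PineauVicolRSSHolds.lean`:
both halves by the compactness argument of Chae–Wolf 2017, §3 — the large-`|α|` half over
`chaeWolf2017_removing_dss_holds` as the source itself remarks on p. 6, the small-`|α|` half with
`α_n → 0` — ending in Tsai 1998, Thm. 1), so the narrowed entry is **proved** as well: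
`LeraySelfSimilarBlowupExclusionNarrow_holds` (last section).

## References

* J. Nečas, M. Růžička, V. Šverák, *On Leray's self-similar solutions of the Navier–Stokes
  equations*, Acta Math. 176 (1996) 283–294: Theorem 1 (p. 291). [NecasRuzickaSverak1996]
* T.-P. Tsai, *On Leray's self-similar solutions of the Navier–Stokes equations satisfying local
  energy estimates*, Arch. Rational Mech. Anal. 143 (1998) 29–51: Theorems 1–2 (p. 31), Lemma 4.2
  (p. 46), proof of Theorem 2 (p. 47). [Tsai1998]
* J. C. Robinson, J. L. Rodrigo, W. Sadowski, *The three-dimensional Navier–Stokes equations*,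
  CUP (2016): Thm. 15.3 (p. 220), Lemma 15.12 (pp. 232–234). [RobinsonRodrigoSadowski2016]
* P. G. Lemarié-Rieusset, *The Navier–Stokes Problem in the 21st Century*, CRC Press (2016):
  Thm. 14.4 (p. 505). [LemarieRieusset2016]
* B. Pineau, V. Vicol, *On rotated backwards self-similar solutions of the incompressible 3D
  Navier–Stokes equations*, arXiv:2607.09619 (2026): Theorem 1.4 (p. 4), p. 6. [PineauVicol2026]
* D. Chae, J. Wolf, Comm. PDE 42 (2017) 1359–1374 = arXiv:1610.09464, Thm. 1.3 and §3.
  [ChaeWolf2017RemovingDSS]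
-/

noncomputable section

namespace Literature.Barriers.NavierStokesRegularity

open Literature.Analysis.FluidPDE

/-- **The Leray self-similar blow-up barrier from Robinson–Rodrigo–Sadowski's Lemma 15.12.**
Granted the local pressure estimate `RRS2016.lemma15_12`, all three exclusion theorems hold:
NRŠ 1996, Thm. 1 by `necas_ruzicka_sverak_of_RRS_steps` (with the proved Step 2,
`RRS2016.step2_force_holds`), Tsai 1998, Thm. 1 unconditionally (`tsai_selfsimilar_holds`), and
Tsai 1998, Thm. 2 by `tsai_selfsimilar_local_energy_of_lemma15_12`. This is the current trust base
of the barrier. [cite: NecasRuzickaSverak1996, Thm 1 (p. 291); Tsai1998, Thms. 1–2 (p. 31); RobinsonRodrigoSadowski2016, Lemma 15.12 pp. 232–234] -/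
theorem leraySelfSimilarBlowupExclusion_of_lemma15_12 (h12 : RRS2016.lemma15_12) :
    LeraySelfSimilarBlowupExclusion :=
  leraySelfSimilarBlowupExclusion_of (necas_ruzicka_sverak_of_RRS_steps RRS2016.step2_force_holds h12)
    tsai_selfsimilar_holds (tsai_selfsimilar_local_energy_of_lemma15_12 h12)

/-- **The Leray self-similar blow-up barrier from Robinson–Rodrigo–Sadowski's Thm. 15.3**
(Caffarelli–Kohn–Nirenberg's Proposition 1 for suitable pairs on the unit cylinder):
`necas_ruzicka_sverak_of_theorem15_3`, `tsai_selfsimilar_holds`,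
`tsai_selfsimilar_local_energy_of_theorem15_3`. [cite: NecasRuzickaSverak1996, Thm 1 (p. 291); Tsai1998, Thms. 1–2 (p. 31); RobinsonRodrigoSadowski2016, Thm. 15.3 p. 220] -/
theorem leraySelfSimilarBlowupExclusion_of_theorem15_3 (h15 : RRS2016.theorem15_3) :
    LeraySelfSimilarBlowupExclusion :=
  leraySelfSimilarBlowupExclusion_of (necas_ruzicka_sverak_of_theorem15_3 h15) tsai_selfsimilar_holds
    (tsai_selfsimilar_local_energy_of_theorem15_3 h15)

/-- **The Leray self-similar blow-up barrier from Lemarié-Rieusset's Thm. 14.4** (the one-scale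
ε-regularity criterion with force): `necas_ruzicka_sverak_of_LR`, `tsai_selfsimilar_holds`,
`tsai_selfsimilar_local_energy_of_LR`. [cite: NecasRuzickaSverak1996, Thm 1 (p. 291); Tsai1998, Thms. 1–2 (p. 31); LemarieRieusset2016, Thm. 14.4 p. 505] -/
theorem leraySelfSimilarBlowupExclusion_of_LR (hLR : lemarieRieusset_epsilon_regularity) :
    LeraySelfSimilarBlowupExclusion :=
  leraySelfSimilarBlowupExclusion_of (necas_ruzicka_sverak_of_LR hLR) tsai_selfsimilar_holds
    (tsai_selfsimilar_local_energy_of_LR hLR)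

/-! ### The discharge -/

/-- **The Leray self-similar blow-up barrier holds** (Nečas–Růžička–Šverák 1996, Thm. 1, p. 291;
Tsai 1998, Thms. 1–2, p. 31): all three exclusion theorems are theorems of the tree, the last
named input — Robinson–Rodrigo–Sadowski's local pressure estimate, Lemma 15.12 — being
discharged by `RRS2016.lemma15_12_holds`; `leraySelfSimilarBlowupExclusion_of_lemma15_12`
applied to it. [cite: NecasRuzickaSverak1996, Thm 1 (p. 291); Tsai1998, Thms. 1–2 (p. 31)] -/
theorem LeraySelfSimilarBlowupExclusion_holds : LeraySelfSimilarBlowupExclusion :=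
  leraySelfSimilarBlowupExclusion_of_lemma15_12 RRS2016.lemma15_12_holds

/-! ### The narrowed entry (audit 2026-08-16): the discharge -/

/-- **The narrowed Leray self-similar blow-up barrier holds**: Leray's non-rotated ansatz is
excluded (Nečas–Růžička–Šverák 1996, Thm. 1; Tsai 1998, Thms. 1–2 —
`LeraySelfSimilarBlowupExclusion_holds`) and so is Perelman's rotated ansatz at extreme angular
speed under a Type I bound (Pineau–Vicol 2026, Thm. 1.4 —
`Literature.Analysis.FluidPDE.pineauVicol2026_rss_liouville_holds`, proved in the tree by the
Chae–Wolf compactness argument for both `|α| ≫ 1` and `|α| ≪ 1`, ending in Tsai's Thm. 1);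
`leraySelfSimilarBlowupExclusionNarrow_of` applied to the two discharges. The trust base of the
narrowed entry is thereby Mathlib's axioms only. [cite: PineauVicol2026, Theorem 1.4 (arXiv:2607.09619 p. 4); NecasRuzickaSverak1996, Thm 1 (p. 291); Tsai1998, Thms. 1–2 (p. 31)] -/
theorem LeraySelfSimilarBlowupExclusionNarrow_holds : LeraySelfSimilarBlowupExclusionNarrow :=
  leraySelfSimilarBlowupExclusionNarrow_of LeraySelfSimilarBlowupExclusion_holds
    pineauVicol2026_rss_liouville_holds

end Literature.Barriers.NavierStokesRegularity

end
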